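import Mathlib
import Literature.AlgebraicGeometry.Tropical.InitialIdeal
import Literature.AlgebraicGeometry.Tropical.TropicalLink
import Summits.ResolutionOfSingularities.ResolutionOfSingularities.Theorems.TropicalLinksInductiveStepRayDegenerationGen

/-!
# TropicalLinks / InductiveStep — the ray fibre ring as a quotient of the image of the partial
# compactification (roadmap brick G0)

Route `ResolutionOfSingularities/TropicalLinks`, crux `InductiveStep` (stmt-ResolutionOfSingularities-17233),
line `split`, in support of stub `stub_sncClosureSchon`.  The dictionary's capstone
(`tropicalLinks_isSchonIdeal_iff_forall_rayFibre`, brick B8) expresses schön-ness through the FIBRE RINGS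
`k[L] ⧸ 𝔣(J)`, `𝔣(J) = linkIdeal inr ((J ∩ k[ℕ × L]) + (x₁))`, of ideals `J ⊆ k[ℤ × L] = k[x₁^±, y^±]`.
The geometric layer of the roadmap (Luxton–Qu strata) naturally produces instead the IMAGE
`B = im(k[ℕ × L] → k[ℤ × L] ⧸ J)` of the partial compactification in the coordinate ring
`𝒪 = k[ℤ × L] ⧸ J` of the very affine variety — the coordinate ring of the closure of `V(J)` in
`𝔸¹ × T_L`, as a subalgebra of `𝒪` — and its principal ideal `(x₁)`.  This file identifies the two:

* `tropicalLinks_nonempty_rayFibre_algEquiv_range_quotient` (registered brick G0) —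
  `k[L] ⧸ 𝔣(J) ≃ₐ[k] B ⧸ (x₁)`.

Pure bookkeeping: `k[ℕ × L] ⧸ (J ∩ k[ℕ × L]) ≃ B` (first isomorphism theorem), then quotient by `x₁` on
both sides (`DoubleQuot.quotQuotEquivQuotSup`) and `k[L] ↠ k[ℕ × L] ⧸ ((J ∩ k[ℕ × L]) + (x₁))` with kernel
`𝔣(J)` (every monomial of positive `x₁`-degree is divisible by `x₁`).  No new definitions.
-/

-- single-problem summit: the doubled namespace component `ResolutionOfSingularities` is forced
set_option linter.dupNamespace false

namespace Summit.ResolutionOfSingularities.ResolutionOfSingularities.Theorems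

open AddMonoidAlgebra Literature.AlgebraicGeometry.Tropical

section RayFibreRange

variable {k : Type} [CommRing k] {L : Type} [AddCommGroup L]

/-- `k[L] → k[ℕ × L] ⧸ (𝔞 + (x₁))` is surjective for every ideal `𝔞`: an element of `k[x₁, y^±]` is its
`x₁`-degree-`0` part (which comes from `k[y^±]`) plus a multiple of `x₁`. [folklore] -/
theorem tropicalLinks_mk_mapDomain_inr_nat_surjective (𝔞 : Ideal (AddMonoidAlgebra k (ℕ × L))) :
    Function.Surjective fun g : AddMonoidAlgebra k L =>
      Ideal.Quotient.mk (𝔞 ⊔ Ideal.span {single ((1 : ℕ), (0 : L)) (1 : k)})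
        (mapDomain (AddMonoidHom.inr ℕ L) g) := by
  intro q
  obtain ⟨f, rfl⟩ := Ideal.Quotient.mk_surjective q
  -- split `f` into its degree-0 part and the rest
  set D : AddMonoidAlgebra k (ℕ × L) := ofCoeff (f.coeff.filter fun u => u.1 = 0) with hD_def
  set E : AddMonoidAlgebra k (ℕ × L) := ofCoeff (f.coeff.filter fun u => ¬ u.1 = 0) with hE_def
  have hsplit : D + E = f := by
    apply coeff_injective
    rw [coeff_add, hD_def, hE_def, coeff_ofCoeff, coeff_ofCoeff, Finsupp.filter_add_filter_not]
  have hDsupp : ∀ u ∈ D.coeff.support, u.1 = 0 := by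
    intro u hu
    rw [hD_def, coeff_ofCoeff, Finsupp.support_filter, Finset.mem_filter] at hu
    exact hu.2
  have hEsupp : ∀ u ∈ E.coeff.support, u.1 ≠ 0 := by
    intro u hu
    rw [hE_def, coeff_ofCoeff, Finsupp.support_filter, Finset.mem_filter] at hu
    exact hu.2
  refine ⟨mapDomain (AddMonoidHom.snd ℕ L) D, ?_⟩
  show Ideal.Quotient.mk _ (mapDomain (AddMonoidHom.inr ℕ L) (mapDomain (AddMonoidHom.snd ℕ L) D)) =
    Ideal.Quotient.mk _ f
  rw [tropicalLinks_mapDomain_inr_mapDomain_snd_nat hDsupp, Ideal.Quotient.eq, ← hsplit,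
    sub_add_cancel_left]
  exact Ideal.mem_sup_right (neg_mem (tropicalLinks_mem_span_single_of_forall_fst_ne_zero hEsupp))

/-- The kernel of `k[L] → k[ℕ × L] ⧸ (𝔞 + (x₁))` is the fibre ideal `linkIdeal inr (𝔞 + (x₁))`.
[folklore] -/
theorem tropicalLinks_ker_mk_comp_mapDomain_inr_nat (𝔞 : Ideal (AddMonoidAlgebra k (ℕ × L))) :
    RingHom.ker ((Ideal.Quotient.mk (𝔞 ⊔ Ideal.span {single ((1 : ℕ), (0 : L)) (1 : k)})).comp
      (mapDomainRingHom k (AddMonoidHom.inr ℕ L))) =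
      linkIdeal (AddMonoidHom.inr ℕ L) (𝔞 ⊔ Ideal.span {single ((1 : ℕ), (0 : L)) (1 : k)}) := by
  ext g
  rw [RingHom.mem_ker, RingHom.comp_apply, Ideal.Quotient.eq_zero_iff_mem, mem_linkIdeal_iff,
    mapDomainRingHom_apply]

end RayFibreRange

/-- **The ray fibre ring is the image of the partial compactification modulo `x₁`** (registered brick
G0).  For an ideal `J ⊆ k[ℤ × L] = k[x₁^±, y^±]` let `B ⊆ 𝒪 := k[ℤ × L] ⧸ J` be the image of
`k[ℕ × L] = k[x₁, y^±]` (the coordinate ring of the closure of `V(J)` in `𝔸¹ × T_L`, as a subalgebra of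
the coordinate ring of `V(J)`).  Then the fibre ring of the dictionary, `k[L] ⧸ linkIdeal inr ((J ∩
k[ℕ × L]) + (x₁))`, is `k`-isomorphic to `B ⧸ (x₁)`. [folklore] -/
theorem tropicalLinks_nonempty_rayFibre_algEquiv_range_quotient :
    ∀ (k : Type) [CommRing k] (L : Type) [AddCommGroup L] (J : Ideal (AddMonoidAlgebra k (ℤ × L))) (B : Subalgebra k (AddMonoidAlgebra k (ℤ × L) ⧸ J)), B = ((Ideal.Quotient.mkₐ k J).comp (AddMonoidAlgebra.mapDomainAlgHom k k ((Nat.castAddMonoidHom ℤ).prodMap (AddMonoidHom.id L)))).range → Nonempty ((AddMonoidAlgebra k L ⧸ Literature.AlgebraicGeometry.Tropical.linkIdeal (AddMonoidHom.inr ℕ L) (Literature.AlgebraicGeometry.Tropical.linkIdeal ((Nat.castAddMonoidHom ℤ).prodMap (AddMonoidHom.id L)) J ⊔ Ideal.span {AddMonoidAlgebra.single ((1 : ℕ), (0 : L)) (1 : k)})) ≃ₐ[k] (↥B ⧸ Ideal.span {x : ↥B | (x : AddMonoidAlgebra k (ℤ × L) ⧸ J) = Ideal.Quotient.mk J (AddMonoidAlgebra.single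 ((1 : ℤ), (0 : L)) (1 : k))})) := by
  intro k _ L _ J B hB
  set castP := (Nat.castAddMonoidHom ℤ).prodMap (AddMonoidHom.id L) with hcastP_def
  set ψ : AddMonoidAlgebra k (ℕ × L) →ₐ[k] AddMonoidAlgebra k (ℤ × L) ⧸ J :=
    (Ideal.Quotient.mkₐ k J).comp (AddMonoidAlgebra.mapDomainAlgHom k k castP) with hψ_def
  have hψ : ∀ f, ψ f = Ideal.Quotient.mk J (mapDomain castP f) := fun f => rfl
  -- kernel of `ψ` is the restriction `J ∩ k[ℕ × L]`
  have hker : RingHom.ker ψ = linkIdeal castP J := by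
    ext f
    rw [RingHom.mem_ker, mem_linkIdeal_iff]
    show ψ f = 0 ↔ _
    rw [hψ, Ideal.Quotient.eq_zero_iff_mem]
  subst hB
  -- first isomorphism theorem onto the range
  have hsurj : Function.Surjective ψ.rangeRestrict := ψ.rangeRestrict_surjective
  let e₁ : (AddMonoidAlgebra k (ℕ × L) ⧸ RingHom.ker ψ.rangeRestrict.toRingHom) ≃ₐ[k] ↥ψ.range :=
    Ideal.quotientKerAlgEquivOfSurjective hsurj
  have hker' : RingHom.ker ψ.rangeRestrict.toRingHom = linkIdeal castP J := by
    rw [← hker]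
    ext f
    simp only [RingHom.mem_ker, AlgHom.toRingHom_eq_coe, AlgHom.coe_toRingHom]
    rw [← Subtype.coe_inj]
    rfl
  -- the generator `x₁` and its images
  set x₁P : AddMonoidAlgebra k (ℕ × L) := single ((1 : ℕ), (0 : L)) (1 : k) with hx₁P
  have hψx₁ : ψ x₁P = Ideal.Quotient.mk J (single ((1 : ℤ), (0 : L)) (1 : k)) := by
    rw [hψ, hx₁P, mapDomain_single]
    rfl
  -- the ideal `(x₁)` of the range is the image of `(x̄₁)` under `e₁`
  have hideal : Ideal.span {x : ↥ψ.range | (x : AddMonoidAlgebra k (ℤ × L) ⧸ J) =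
      Ideal.Quotient.mk J (single ((1 : ℤ), (0 : L)) (1 : k))} =
      (Ideal.map (Ideal.Quotient.mk (RingHom.ker ψ.rangeRestrict.toRingHom)) (Ideal.span {x₁P})).map e₁ := by
    rw [Ideal.map_span, Ideal.map_span, Set.image_singleton, Set.image_singleton]
    congr 1
    ext x
    simp only [Set.mem_setOf_eq, Set.mem_singleton_iff]
    rw [← hψx₁]
    constructor
    · intro hx
      apply Subtype.ext
      rw [hx]
      rfl
    · intro hx
      rw [hx]
      rfl
  let e₂ : ((AddMonoidAlgebra k (ℕ × L) ⧸ RingHom.ker ψ.rangeRestrict.toRingHom) ⧸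
      Ideal.map (Ideal.Quotient.mk (RingHom.ker ψ.rangeRestrict.toRingHom)) (Ideal.span {x₁P})) ≃ₐ[k]
      (↥ψ.range ⧸ Ideal.span {x : ↥ψ.range | (x : AddMonoidAlgebra k (ℤ × L) ⧸ J) =
        Ideal.Quotient.mk J (single ((1 : ℤ), (0 : L)) (1 : k))}) :=
    Ideal.quotientEquivAlg _ _ e₁ (by rw [hideal]; rfl)
  -- double quotient = quotient by the sum
  let e₃ : ((AddMonoidAlgebra k (ℕ × L) ⧸ RingHom.ker ψ.rangeRestrict.toRingHom) ⧸
      Ideal.map (Ideal.Quotient.mk (RingHom.ker ψ.rangeRestrict.toRingHom)) (Ideal.span {x₁P})) ≃ₐ[k]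
      (AddMonoidAlgebra k (ℕ × L) ⧸ (linkIdeal castP J ⊔ Ideal.span {x₁P})) :=
    (DoubleQuot.quotQuotEquivQuotSupₐ k _ _).trans (Ideal.quotientEquivAlgOfEq k (by rw [hker']))
  -- `k[L] ⧸ fibre ideal ≃ k[ℕ × L] ⧸ (J ∩ k[ℕ × L] + (x₁))`
  let φ : AddMonoidAlgebra k L →ₐ[k] AddMonoidAlgebra k (ℕ × L) ⧸ (linkIdeal castP J ⊔ Ideal.span {x₁P}) :=
    (Ideal.Quotient.mkₐ k _).comp (AddMonoidAlgebra.mapDomainAlgHom k k (AddMonoidHom.inr ℕ L))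
  have hφsurj : Function.Surjective φ := tropicalLinks_mk_mapDomain_inr_nat_surjective (linkIdeal castP J)
  have hφker : RingHom.ker φ.toRingHom =
      linkIdeal (AddMonoidHom.inr ℕ L) (linkIdeal castP J ⊔ Ideal.span {x₁P}) :=
    tropicalLinks_ker_mk_comp_mapDomain_inr_nat (linkIdeal castP J)
  let e₄ : (AddMonoidAlgebra k L ⧸ linkIdeal (AddMonoidHom.inr ℕ L) (linkIdeal castP J ⊔ Ideal.span {x₁P})) ≃ₐ[k]
      (AddMonoidAlgebra k (ℕ × L) ⧸ (linkIdeal castP J ⊔ Ideal.span {x₁P})) :=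
    (Ideal.quotientEquivAlgOfEq k hφker.symm).trans (Ideal.quotientKerAlgEquivOfSurjective hφsurj)
  exact ⟨e₄.trans (e₃.symm.trans e₂)⟩

end Summit.ResolutionOfSingularities.ResolutionOfSingularities.Theorems
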